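import Mathlib
import HarnessLib
import Literature.Analysis.FluidPDE.VorticityCalculus
import Summits.NavierStokesRegularity.NavierStokesRegularity.Theses.PoloidalWindowDoor
import Summits.NavierStokesRegularity.NavierStokesRegularity.Theses.LoopPeriodRatchet
import Summits.NavierStokesRegularity.NavierStokesRegularity.Theorems.PoloidalWindowDoorPoloidalWindowRigidityHotLoopsReduction
import Summits.NavierStokesRegularity.NavierStokesRegularity.Theorems.PoloidalWindowDoorPoloidalWindowRigidityFirstIntegral
import Summits.NavierStokesRegularity.NavierStokesRegularity.Theorems.PoloidalWindowDoorPoloidalWindowRigidityHotPlaneConst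
import Summits.NavierStokesRegularity.NavierStokesRegularity.Theorems.PoloidalWindowDoorPoloidalWindowRigidityZeroModeNoHotPlane
import Summits.NavierStokesRegularity.NavierStokesRegularity.Theorems.PoloidalWindowDoorPoloidalWindowRigidityHotSplitRidgeReductions
import Summits.NavierStokesRegularity.NavierStokesRegularity.Theorems.PoloidalWindowDoorPoloidalWindowRigidityHotSplitRidgeKernels
import Summits.NavierStokesRegularity.NavierStokesRegularity.Theorems.PoloidalWindowDoorPoloidalWindowRigidityHotSplitCells
import Summits.NavierStokesRegularity.NavierStokesRegularity.Theorems.PoloidalWindowDoorPoloidalWindowRigidityHotSplitComposition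

/-!
# (v1.2 — critic PASS 03:39Z ask A1: analyticity/regularity sources named BY TREE DECL in the R12/R13/R14 docstrings (`IsTypeIAncientMild.analyticOnNhd_slice_univ`, PROVED; `isTypeIAncientMild_of_class`); no premise added, statements byte-same.)
# (v1.1 — critic A1/A2 carried over from leaf_uniform: HL3′ and the two compositions rewired BY NAME through `…HotSplitCells.peaklessEmpty_of_ridges` / `…HotSplitComposition…_of_residues`; hand-prover note in the R10 docstring; instrument I19a = kit j324109; mathematics unchanged)
# Crux `PoloidalWindowRigidity` (K2, stmt-NavierStokesRegularity-19708) + item `LrcModEntire` (stmt-20428) — LINE 19 `null_leaf`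
# (IDEATOR seat ns-idea-8, generation 9; lens «barrier»; bears_on LADDER-NS N0, rung N0-LocalTubeDoorPoloidal, THICK column; targets the
#  research residue C2b′ `stub_cellC2bRidge` (THE NULL RIDGE) of LINE 15 `hot_split` v1.6 (tree `Lines/hot_split.lean` 0dd9c4b44e10), verbatim.)

**No summit and no crux is proved here.**  `PoloidalWindowRigidity_of_nullLeaf` / `LrcModEntire_of_nullLeaf` are CONDITIONAL on the sorried
stubs, exactly like every line of the column; the new content is the typed structure of the NULL RIDGE (the hot set made of vorticity zeros) and a
glued, tangent-free trichotomy of C2b′.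

## Why this line (barrier-inversion, second residue)

In C2b′ every hot point `y ∈ H ⊂ P₀` is a zero of `ω(−1,·)` and a critical point of `w := v₂(−1,·)` (`w = N` on `H`).  The census (hot_split C2b docstring,
CENSUS-C2-g8) records one obstruction: «finite-jet barrier — jets at the ridge are consistent to all orders».  Consistent, yes; but the 2-jet of the FROZEN
LAW at a point where BOTH factors vanish is a clean algebraic law that has not been typed, and it organises the residue:

* **2-jet antisymmetry.**  `G(x) := ω(x)·∇w(x) ≡ 0` (frozen law at `s = −1`, `ω₂ ≡ 0`).  At `y ∈ H` both `ω(y) = 0` and `∇w(y) = 0`, so the second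
  derivative of `G` at `y` is the symmetrisation of `(Dω(y))ᵀ·Hess w(y)`: **`⟪Dω(y)a, Hess w(y)b⟫ + ⟪Dω(y)b, Hess w(y)a⟫ = 0` for all `a, b`.**
* **Limit tangent.**  `y` is not isolated in `H` (a compact isolated hot piece `{y}` is excluded by R3, a hypothesis of C2b′), so hot points `y_k → y`
  accumulate along some horizontal unit direction `T`; since `∇w` and `ω` vanish at `y_k` and at `y` and are differentiable, `Hess w(y)·T = 0` and
  `Dω(y)·T = 0`.
* **Structure of `Dω`.**  `(Dω(y)d)₂ = 0` (`ω₂ ≡ 0`) and `tr Dω(y) = div ω = 0`; with `Dω·T = 0` this gives, in the frame `(T, n := e₂ × T, e₂)`,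
  `Dω(y)·n = αT` (the `n`-component vanishes by the trace) and `Dω(y)·e₂ = β_T T + β_n n`; and `Hess w(y) = [[0,0,0],[0,w_nn,w_nz],[0,w_nz,w_zz]]`.
* **Matrix algebra.**  `(Dω)ᵀHess w = [[0,0,0],[0,0,0],[0, β_n w_nn, β_n w_nz]]`; antisymmetry forces **`β_n·w_nn = 0` and `β_n·w_nz = 0`.**

Hence the **COVER LAW R12**: every hot null point is HORIZONTALLY FLAT (`Hess w(y) = w_zz e₂⊗e₂`: every second derivative of `w` with a horizontal
slot vanishes) or a LAYER POINT (`β_n = 0`, so `Dω(y) = T ⊗ (α n♭ + β_T dz)` has rank ≤ 1: to first order the vorticity near `y` is `(αλ + β_T z)·T`,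
parallel to the ridge and REVERSING across the surface `{αλ + β_T z = 0} ∋ y` — a vortex layer centred on the hot ridge).  Both alternatives are closed,
frame-free conditions (`HFlat`, `RankLeOne`), so the residue splits WITHOUT choosing tangents:

* **cell NULL-FLAT** `CellNullFlat`: every hot point is horizontally flat (`w − N = O(dist⁴)` transversally in `P₀`, `Δw = w_zz` on `H`, with the time
  pin `−σ∂_z p = |N|/2 − σw_zz ≥ |N|/2` on all of `H`);
* **cell LAYER-H** `CellLayerHorizontal`: some non-flat hot point has `D_hω(y) = 0` (`α = 0`: the reversal surface is TANGENT to the hot plane at `y`;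
  `Dω(y) = β_T T⊗dz`, possibly `0` — the most degenerate configuration, expected isolated on `H`);
* **cell LAYER-T** `CellLayerTransverse`: some non-flat hot point has `D_hω(y) ≠ 0` (`α ≠ 0`).  Here two more structures come for free and are handed
  to the cell: **R13 `LayerArc`** — an ANALYTIC ARC of hot points through `y` (the reversal surface `{⟪ω, u⟫ = 0}`, `u := Dω(y)h ≠ 0`, is an analytic
  surface transverse to `P₀` at `y` (analytic IFT, tree `Literature.Analysis.Calculus.ImplicitChart.analyticAt_implicitFunction`); `H` near `y` lies on
  the analytic curve `Σ ∩ P₀`; `w − N` restricted to it is analytic with zeros accumulating at `y` (non-isolation), hence `≡ 0`: the whole arc is hot); and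
  **R14 `LayerInvariant`** — along any analytic hot null arc on which the cover law holds pointwise, the CONTACT RATIO `J₁ := w_nn/α` is CONSTANT:
  `w_nn(γ τ)·α(γ 0) = w_nn(γ 0)·α(γ τ)`.  Proof: third derivative `(n,n,n)` of `G ≡ 0` at an arc point where `Dω = T⊗ℓ`:
  `G_nnn = 3(ℓ_n w_Tnn + ∂_n∂_nω_n · w_nn) = 0`; along the arc `d/dτ w_nn = w_nnT` (`Hess w·T = 0` kills the frame terms) and
  `d/dτ α = ∂_T∂_nω_T = −∂_n∂_nω_n` (`∂_Tω_T + ∂_nω_n = div ω − ∂_zω_z = 0` identically); so `α·w_nn′ − α′·w_nn = 0` where `α ≠ 0`, and analyticity in `τ`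
  carries the identity `w_nn(τ)α(0) = w_nn(0)α(τ)` across the zeros of `α` and the flat points.  (With the Clebsch potential, `ω_h = ∇ₕ^⊥ψ`: `α = −ψ_nn`,
  `J₁ = −Φ_ψ` where `w − N ≈ Φ_ψ·(ψ − c)` — the vertical-velocity excess is proportional to the stream-function excess with ONE constant along the whole
  ridge; a second leaf constant `K := (w_nz − J₁ψ_nz)/|α|^{1/2}` follows from `G_nnz = 0` and is recorded here only.)

So C2b′ ⇐ R10 ∧ R12 ∧ R13 ∧ R14 ∧ NULL-FLAT ∧ LAYER-H ∧ LAYER-T by a sorry-free kernel (`cellC2bRidge_of_null`: two `by_cases` and bookkeeping); the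
statement of `stub_cellC2bRidge` is DERIVED verbatim.  HONEST LABEL: a typed census row for the null ridge with four provable hand targets (R10 S/M —
the SAME statement as leaf_uniform's R10, one job closes both; R12 M; R13 M/L; R14 M/L) and three OPEN research cells; no closing mechanism is claimed.

Why the cells might still fail / why open: all three laws are kinematic (frozen law + `div ω = 0` + poloidality) plus the pins; NS enters only through
R10 (`−∂_z p = N/2 − Δw` on `H`).  LAYER-T is the generic null ridge: an unbounded (R5) analytic vortex-reversal layer with hot core, `w − N ≈ −J₁(ψ − c)`;
a kill needs the dynamics of the layer (viscous spreading of a reversal layer is incompatible with Type-I ancient SELF-SIMILAR persistence?) or recurrence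
along the unbounded arc — not carried out.  NULL-FLAT contains the translation limits of LAYER-T with `J₁α → 0` and is the C2b-twin of leaf_uniform's FLAT LEAF.

## Dead lines avoided (CENSUS-C2-g8 / HL3-census / seat g9)
Not a finite-jet CONTRADICTION claim (C1/B-g8-1: the 2-jet law is used to SPLIT, and R14 compares jets at different points); not averaged (B-g8-2/4); no
comparison principle (B-g8-5); `ψ` only inside proofs (C4); not thread_axis' threaded-zero road (that line sits in the (TH)/thread class with `ω(p₀) = 0`
at ONE point and a flat-threaded residue S3′ — here the zero set is a whole ridge inside the hot set and the lever is the frozen law's 2-jet, absent there);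
parabolic unique continuation at an infinite-order vorticity zero is VACUOUS here (the slice is analytic: finite order is automatic unless `ω(−1) ≡ 0`) —
recorded so nobody files it.

## Cheapest falsifier / instrument row
R12/R14: one explicit horizontal div-free `C²` field `X` and `C³` function `w` on `ℝ³` with `X·∇w ≡ 0`, a curve `Γ ⊂ {y₂ = 0}` on which `X = 0`, `∇w = 0`,
violating the cover law at a point or the constancy of `w_nn/α` along `Γ` (instrument I19a: exact check on the local model `ψ = c + a(x₀)λ² + b(x₀)λz + Cz +
d(x₀)z²`, `λ = x₁ − κx₀²/2` (curved ridge), `w = N + Φ(ψ − c, z)` — planned in the card).  R13: a closed perfect subset of an analytic arc that is the zero set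
of a non-negative analytic function without being the arc (impossible in 1-D: identity theorem — the proof).  Cells: only a class profile (Liouville conjecture).
-/

open scoped InnerProductSpace RealInnerProductSpace Laplacian

-- the summit and its single sub-problem share the name (CONVENTIONS §1)
set_option linter.dupNamespace false

namespace Summit.NavierStokesRegularity.NavierStokesRegularity.Cruxes.PoloidalWindowRigidity.NullLeaf

open Set Function MeasureTheory
open Literature.Analysis Literature.Analysis.FluidPDE
open Summit.NavierStokesRegularity.NavierStokesRegularity.Theses.LoopPeriodRatchet
open Summit.NavierStokesRegularity.NavierStokesRegularity.Theses.PoloidalWindowDoor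
open Summit.NavierStokesRegularity.NavierStokesRegularity.Theorems

/-! ## The hypothesis packages of HL3′ (VERBATIM hot_split v1.6) -/

/-- **Pinned** — VERBATIM hot_split: Type-I decay, continuity, mild identity, div-free, e₃-poloidal, `N := v₂(−1,0) ≠ 0`, the global bound
`√(−t)|v₂| ≤ |N|`, `∇v₂(−1,0) = 0`, the time and Laplace pins. -/
def Pinned (C : ℝ) (v : ℝ → EuclideanSpace ℝ (Fin 3) → EuclideanSpace ℝ (Fin 3)) : Prop :=
  Literature.Analysis.FluidPDE.HasTypeITimeDecay C v ∧
  ContinuousOn (Function.uncurry v) (Set.Iio (0 : ℝ) ×ˢ Set.univ) ∧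
  (∀ s t : ℝ, s < t → t < 0 → ∀ x, v t x =
    Literature.Analysis.UnboundedOperators.heatExtension (v s) (t - s) x -
      Literature.Analysis.FluidPDE.oseenDuhamel 1 s v v t x) ∧
  (∀ t < 0, Literature.Analysis.FluidPDE.VectorCalculus.IsDivFree (v t)) ∧
  (∀ s < 0, ∀ y, ⟪Literature.Analysis.FluidPDE.curl (v s) y, EuclideanSpace.single 2 1⟫_ℝ = 0) ∧
  v (-1) 0 2 ≠ 0 ∧ (∀ t < 0, ∀ x, Real.sqrt (-t) * |v t x 2| ≤ |v (-1) 0 2|) ∧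
  (∀ h : EuclideanSpace ℝ (Fin 3), fderiv ℝ (v (-1)) 0 h 2 = 0) ∧
  (deriv (fun s => v s 0 2) (-1) = v (-1) 0 2 / 2 ∧ v (-1) 0 2 * (Δ (fun y => v (-1) y 2)) 0 ≤ 0)

/-- **ThickWindow** — VERBATIM hot_split. -/
def ThickWindow (v : ℝ → EuclideanSpace ℝ (Fin 3) → EuclideanSpace ℝ (Fin 3)) (W : Set (ℝ × EuclideanSpace ℝ (Fin 3))) : Prop :=
  IsOpen W ∧ W ⊆ Set.Iio (0 : ℝ) ×ˢ Set.univ ∧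
  (∀ z ∈ W, (Literature.Analysis.FluidPDE.curl (v z.1) z.2 ≠ 0 ∧
      (fderiv ℝ (v z.1) z.2 (EuclideanSpace.single 0 1) 2 ≠ 0 ∨ fderiv ℝ (v z.1) z.2 (EuclideanSpace.single 1 1) 2 ≠ 0) ∧
      (fderiv ℝ (v z.1) z.2 (EuclideanSpace.single 2 1) 0 ≠ 0 ∨ fderiv ℝ (v z.1) z.2 (EuclideanSpace.single 2 1) 1 ≠ 0)) ∧
    (fderiv ℝ (fun x => fderiv ℝ (v z.1) x (EuclideanSpace.single 2 1) 2) z.2 (EuclideanSpace.single 0 1) *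
          fderiv ℝ (v z.1) z.2 (EuclideanSpace.single 1 1) 2 -
        fderiv ℝ (fun x => fderiv ℝ (v z.1) x (EuclideanSpace.single 2 1) 2) z.2 (EuclideanSpace.single 1 1) *
          fderiv ℝ (v z.1) z.2 (EuclideanSpace.single 0 1) 2 ≠ 0)) ∧
  (∀ m : ℝ → ℝ → ℝ, ∀ W₁ : Set (ℝ × EuclideanSpace ℝ (Fin 3)), W₁ ⊆ W → IsOpen W₁ → W₁.Nonempty →
      ∃ z ∈ W₁, ∃ b : Fin 3, b ≠ 2 ∧
        fderiv ℝ (v z.1) z.2 (EuclideanSpace.single 2 1) b ≠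
          m z.1 (z.2 2) * fderiv ℝ (v z.1) z.2 (EuclideanSpace.single b 1) 2) ∧
  (∀ r : ℝ, 0 < r → (Metric.ball ((-1 : ℝ), (0 : EuclideanSpace ℝ (Fin 3))) r ∩ W).Nonempty)

/-- **Peakless** — VERBATIM hot_split: no island bracket of `σ·v₂(s,·)` on any horizontal plane at any time `s < 0`. -/
def Peakless (v : ℝ → EuclideanSpace ℝ (Fin 3) → EuclideanSpace ℝ (Fin 3)) : Prop :=
  ∀ (s z₀ σ M : ℝ) (K O : Set (EuclideanSpace ℝ (Fin 3))), s < 0 →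
    ((σ = 1 ∨ σ = -1) ∧ IsCompact K ∧ K.Nonempty ∧ (∀ y ∈ K, y 2 = z₀ ∧ σ * v s y 2 = M) ∧
      IsOpen O ∧ K ⊆ O ∧ (∀ y ∈ O, y 2 = z₀ → σ * v s y 2 ≤ M) ∧
      (∀ y ∈ O, y 2 = z₀ → σ * v s y 2 = M → y ∈ K)) → False

/-- The HOT SET of the hot-spot plane `P₀ = {y₂ = 0}` at time `−1` — VERBATIM hot_split: `H := {y : y₂ = 0, v₂(−1,y) = v₂(−1,0)}`. -/
def hotSet (v : ℝ → EuclideanSpace ℝ (Fin 3) → EuclideanSpace ℝ (Fin 3)) : Set (EuclideanSpace ℝ (Fin 3)) :=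
  {y | y 2 = 0 ∧ v (-1) y 2 = v (-1) 0 2}

/-! ## Null-ridge vocabulary (second derivatives of `w := v₂(−1,·)` and the derivative of `ω(−1,·)`; frame-free predicates) -/

/-- `∂_b∂_a v₂(−1,·)(y)` — the second derivative of the vertical component of the time-`−1` slice, nested `fderiv` convention of the column. -/
noncomputable def hess (v : ℝ → EuclideanSpace ℝ (Fin 3) → EuclideanSpace ℝ (Fin 3)) (y a b : EuclideanSpace ℝ (Fin 3)) : ℝ :=
  fderiv ℝ (fun x => fderiv ℝ (fun x' => v (-1) x' 2) x a) y b


/-- **Horizontally flat hot point**: every second derivative of `w = v₂(−1,·)` at `y` with a HORIZONTAL slot vanishes (`Hess w(y) = w_zz e₂⊗e₂`). -/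
def HFlat (v : ℝ → EuclideanSpace ℝ (Fin 3) → EuclideanSpace ℝ (Fin 3)) (y : EuclideanSpace ℝ (Fin 3)) : Prop :=
  ∀ a b : EuclideanSpace ℝ (Fin 3), a 2 = 0 → hess v y a b = 0 ∧ hess v y b a = 0

/-- A linear map `ℝ³ → ℝ³` has RANK ≤ 1: all `2×2` minors of any two image vectors vanish (the images are pairwise parallel). -/
def RankLeOne (L : EuclideanSpace ℝ (Fin 3) →L[ℝ] EuclideanSpace ℝ (Fin 3)) : Prop :=
  ∀ a b : EuclideanSpace ℝ (Fin 3), ∀ i j : Fin 3, L a i * L b j = L a j * L b i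

/-- A linear map `ℝ³ → ℝ³` KILLS THE HORIZONTAL directions (`D_h = 0`). -/
def DhZero (L : EuclideanSpace ℝ (Fin 3) →L[ℝ] EuclideanSpace ℝ (Fin 3)) : Prop :=
  ∀ h : EuclideanSpace ℝ (Fin 3), h 2 = 0 → L h = 0

/-- Horizontal rotation by `+90°`: `rot (h₀, h₁, h₂) := (−h₁, h₀, 0)` (for a horizontal tangent `T` of the ridge, `rot T` is its in-plane normal, up to length). -/
noncomputable def rot (h : EuclideanSpace ℝ (Fin 3)) : EuclideanSpace ℝ (Fin 3) :=
  EuclideanSpace.single 0 (-(h 1)) + EuclideanSpace.single 1 (h 0)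

/-- `W(τ) := Hess w(γ τ)(rot γ′(τ), rot γ′(τ))` — the transversal second derivative of `w` along a parametrised planar arc (`= ‖γ′‖²·w_nn`). -/
noncomputable def layerW (v : ℝ → EuclideanSpace ℝ (Fin 3) → EuclideanSpace ℝ (Fin 3)) (γ : ℝ → EuclideanSpace ℝ (Fin 3)) (τ : ℝ) : ℝ :=
  hess v (γ τ) (rot (deriv γ τ)) (rot (deriv γ τ))

/-- `A(τ) := ⟪Dω(γ τ)(rot γ′(τ)), γ′(τ)⟫` — the vorticity SHEAR RATE across the ridge (`= ‖γ′‖²·α`, `α = ∂ₙω_T`). -/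
noncomputable def layerA (v : ℝ → EuclideanSpace ℝ (Fin 3) → EuclideanSpace ℝ (Fin 3)) (γ : ℝ → EuclideanSpace ℝ (Fin 3)) (τ : ℝ) : ℝ :=
  ⟪fderiv ℝ (Literature.Analysis.FluidPDE.curl (v (-1))) (γ τ) (rot (deriv γ τ)), deriv γ τ⟫_ℝ

/-- An **analytic hot arc carrying the cover law**: `γ` analytic and regular on `(−ε, ε)`, inside the hot set, and at each of its points the profile is
horizontally flat or a layer point. -/
def IsNullArc (v : ℝ → EuclideanSpace ℝ (Fin 3) → EuclideanSpace ℝ (Fin 3)) (γ : ℝ → EuclideanSpace ℝ (Fin 3)) (ε : ℝ) : Prop :=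
  0 < ε ∧ ∀ τ ∈ Set.Ioo (-ε) ε, γ τ ∈ hotSet v ∧ AnalyticAt ℝ γ τ ∧ deriv γ τ ≠ 0 ∧
    (HFlat v (γ τ) ∨ RankLeOne (fderiv ℝ (Literature.Analysis.FluidPDE.curl (v (-1))) (γ τ)))

/-! ## The provable structure stubs (hand targets) -/

/-- **R10 `HotTimePin` (PROVABLE, S/M; LOAD-BEARING: handed to both cells).**  The time pin holds at EVERY hot point:
`∂ₜv₂(−1,y) = N/2` for `y ∈ H` (each hot point maximises `√(−t)σv₂` over `(−∞,0) × ℝ³`; differentiability in `t` of the classical solution; tree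
pattern `…HotSpot.hotSpot_firstOrder`).  With vertical NS at a critical point of `v₂`: `−∂_z p(−1,y) = N/2 − Δv₂(−1,y)` on all of `H`.
v1.1 note for the hand prover (critic A2 on leaf_uniform, same statement): `deriv` forces the proof through time-differentiability of the mild
Type-I ancient solution at `t = −1` (tree `Literature.Analysis.FluidPDE.TypeIAncientMildClassical` / `…HotSpot.hotSpot_firstOrder` pattern); with `deriv`-junk
alone it would read `0 = N/2` — size S/M. -/
def HotTimePin : Prop :=
  ∀ (C : ℝ) (v : ℝ → EuclideanSpace ℝ (Fin 3) → EuclideanSpace ℝ (Fin 3)), Pinned C v →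
    ∀ y ∈ hotSet v, deriv (fun s => v s y 2) (-1) = v (-1) 0 2 / 2

/-- **stub R10** (PROVABLE, S/M). -/
theorem stub_hotTimePin : HotTimePin := by
  sorry

/-- **R12 `NullCoverLaw` (PROVABLE, M; LOAD-BEARING).**  In a pinned profile with the frozen law whose hot set is closed, critical, without compact
isolated pieces and made of vorticity zeros, EVERY hot point is horizontally flat or a layer point (`rank Dω(y) ≤ 1`).  Proof in the file header:
limit tangent `T` from non-isolation (R3 with `K = {y}`), `Hess w·T = 0`, `Dω·T = 0`, the 2-jet antisymmetry of `ω·∇w ≡ 0` at `y`, `(Dω d)₂ = 0`,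
`tr Dω = 0`, and `3×3` matrix algebra (`β_n w_nn = β_n w_nz = 0`).  Smoothness of the slice: tree `IsTypeIAncientMild.contDiff_slice`, `contDiff_curl`. REGULARITY SOURCE BY NAME (v1.2): `C^∞` slice from `(isTypeIAncientMild_of_class hrate hcont hmild hdiv).contDiff_slice` (tree), as hot_split's R-proofs. -/
def NullCoverLaw : Prop :=
  ∀ (C : ℝ) (v : ℝ → EuclideanSpace ℝ (Fin 3) → EuclideanSpace ℝ (Fin 3)), Pinned C v →
    (∀ s < 0, ∀ y, ⟪fderiv ℝ (v s) y (Literature.Analysis.FluidPDE.curl (v s) y), EuclideanSpace.single 2 1⟫_ℝ = 0) →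
    IsClosed (hotSet v) → (∀ y ∈ hotSet v, fderiv ℝ (fun x => v (-1) x 2) y = 0) →
    (∀ K O : Set (EuclideanSpace ℝ (Fin 3)), IsCompact K → K.Nonempty → K ⊆ hotSet v → IsOpen O → K ⊆ O →
      O ∩ hotSet v ⊆ K → False) →
    (∀ y ∈ hotSet v, Literature.Analysis.FluidPDE.curl (v (-1)) y = 0) →
    ∀ y ∈ hotSet v, HFlat v y ∨ RankLeOne (fderiv ℝ (Literature.Analysis.FluidPDE.curl (v (-1))) y)

/-- **stub R12** (PROVABLE, M). -/
theorem stub_nullCoverLaw : NullCoverLaw := by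
  sorry

/-- **R13 `LayerArc` (PROVABLE, M/L; handed to the transverse layer cell).**  Through a hot null point `y` at which `Dω(y)` does NOT kill the horizontal
directions there is an ANALYTIC REGULAR ARC of hot points: with `u := Dω(y)h ≠ 0` (`h` horizontal), the analytic function `f := ⟪ω(−1,·), u⟫` has
`∂_h f(y) = ‖u‖² ≠ 0`, so `{f = 0} ∩ P₀` is an analytic curve near `y` (analytic IFT, tree `Literature.Analysis.Calculus.ImplicitChart`); `H ⊆ {ω = 0} ∩ P₀`
lies on it near `y`; `w − N` along the curve is analytic with zeros accumulating at `y` (`y` is not isolated in `H`: R3 with `K = {y}`), hence `≡ 0`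
(identity theorem): the whole arc is hot.
ANALYTICITY SOURCE BY NAME (v1.2, critic A1): the real-analyticity of the slice `x ↦ v (−1) x` on `univ` is the tree's PROVED
`Literature.Analysis.FluidPDE.IsTypeIAncientMild.analyticOnNhd_slice_univ` (from `lemarieRieusset2016_local_analyticity_holds`, PROVED) applied to
`…Theorems.PoloidalWindowDoorPoloidalWindowRigidityWindow.isTypeIAncientMild_of_class hrate hcont hmild hdiv` (the first four conjuncts of `Pinned`) —
exactly hot_split's route (`Lines/hot_split.lean` R-proofs); analyticity of `curl (v (−1))` and of `x ↦ v (−1) x 2` follows by `AnalyticOnNhd.fderiv` /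
continuous-linear composition.  No Literature fact is assumed as a premise. -/
def LayerArc : Prop :=
  ∀ (C : ℝ) (v : ℝ → EuclideanSpace ℝ (Fin 3) → EuclideanSpace ℝ (Fin 3)), Pinned C v →
    IsClosed (hotSet v) →
    (∀ K O : Set (EuclideanSpace ℝ (Fin 3)), IsCompact K → K.Nonempty → K ⊆ hotSet v → IsOpen O → K ⊆ O →
      O ∩ hotSet v ⊆ K → False) →
    (∀ y ∈ hotSet v, Literature.Analysis.FluidPDE.curl (v (-1)) y = 0) →
    ∀ y ∈ hotSet v, ¬ DhZero (fderiv ℝ (Literature.Analysis.FluidPDE.curl (v (-1))) y) →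
      ∃ (γ : ℝ → EuclideanSpace ℝ (Fin 3)) (ε : ℝ), 0 < ε ∧ γ 0 = y ∧
        ∀ τ ∈ Set.Ioo (-ε) ε, γ τ ∈ hotSet v ∧ AnalyticAt ℝ γ τ ∧ deriv γ τ ≠ 0

/-- **stub R13** (PROVABLE, M/L). -/
theorem stub_layerArc : LayerArc := by
  sorry

/-- **R14 `LayerInvariant` (PROVABLE, M/L; handed to the transverse layer cell).**  Along an analytic hot arc carrying the cover law, in a pinned profile
with the frozen law whose hot points are critical vorticity zeros, the CONTACT RATIO `w_nn/α` is constant, in cross-multiplied (zero-safe,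
parametrisation-free) form: `W(τ)·A(0) = W(0)·A(τ)` with `W = layerW`, `A = layerA`.  Proof in the file header (`G_nnn = 0`, `div ω = 0`, frame terms
killed by `Hess w·T = 0` / `Dω·T = 0`, analyticity in `τ` across the zeros of `α` and the flat points). ANALYTICITY SOURCE BY NAME (v1.2): as in R13 (`IsTypeIAncientMild.analyticOnNhd_slice_univ` ∘ `isTypeIAncientMild_of_class`); the 1-D identity theorem is Mathlib's
`AnalyticOnNhd.eqOn_zero_of_preconnected_of_frequently_eq_zero` on `Set.Ioo (-ε) ε`. -/
def LayerInvariant : Prop :=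
  ∀ (C : ℝ) (v : ℝ → EuclideanSpace ℝ (Fin 3) → EuclideanSpace ℝ (Fin 3)), Pinned C v →
    (∀ s < 0, ∀ y, ⟪fderiv ℝ (v s) y (Literature.Analysis.FluidPDE.curl (v s) y), EuclideanSpace.single 2 1⟫_ℝ = 0) →
    (∀ y ∈ hotSet v, fderiv ℝ (fun x => v (-1) x 2) y = 0) →
    (∀ y ∈ hotSet v, Literature.Analysis.FluidPDE.curl (v (-1)) y = 0) →
    ∀ (γ : ℝ → EuclideanSpace ℝ (Fin 3)) (ε : ℝ), IsNullArc v γ ε →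
      ∀ τ ∈ Set.Ioo (-ε) ε, layerW v γ τ * layerA v γ 0 = layerW v γ 0 * layerA v γ τ

/-- **stub R14** (PROVABLE, M/L). -/
theorem stub_layerInvariant : LayerInvariant := by
  sorry

/-! ## The research cells (OPEN): every binder of C2b′ VERBATIM, plus the cell datum, plus the time pin on the hot set -/

/-- **Cell NULL-FLAT `CellNullFlat` (OPEN, research).**  C2b′ in which EVERY hot point is horizontally flat (`Hess w = w_zz e₂⊗e₂` on all of `H`), with
the time pin on `H`.  Why it might fail / why open: flatness of all horizontal second derivatives along the ridge is consistent with every finite jet; the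
only global inputs are the bound `√(−t)|v₂| ≤ |N|` and the ancient history — no mechanism recorded (twin of leaf_uniform's FLAT LEAF). -/
def CellNullFlat : Prop :=
    ∀ (C : ℝ) (v : ℝ → EuclideanSpace ℝ (Fin 3) → EuclideanSpace ℝ (Fin 3)) (W : Set (ℝ × EuclideanSpace ℝ (Fin 3))),
      Pinned C v → ThickWindow v W → Peakless v →
      (∀ s < 0, ∀ y, ⟪fderiv ℝ (v s) y (Literature.Analysis.FluidPDE.curl (v s) y), EuclideanSpace.single 2 1⟫_ℝ = 0) →
      IsClosed (hotSet v) → (∀ y ∈ hotSet v, fderiv ℝ (fun x => v (-1) x 2) y = 0) →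
      (∀ K O : Set (EuclideanSpace ℝ (Fin 3)), IsCompact K → K.Nonempty → K ⊆ hotSet v → IsOpen O → K ⊆ O →
        O ∩ hotSet v ⊆ K → False) →
      (∀ y ∈ hotSet v, ∀ r : ℝ, 0 < r →
        ∃ y' : EuclideanSpace ℝ (Fin 3), y' 2 = 0 ∧ dist y' y < r ∧ v (-1) y' 2 ≠ v (-1) 0 2) →
      (∀ y ∈ hotSet v, Literature.Analysis.FluidPDE.curl (v (-1)) y = 0) →
      (∀ y ∈ hotSet v, HFlat v y) →
      (∀ y ∈ hotSet v, deriv (fun s => v s y 2) (-1) = v (-1) 0 2 / 2) →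
      False

/-- **stub NULL-FLAT** (OPEN, research). -/
theorem stub_cellNullFlat : CellNullFlat := by
  sorry

/-- **Cell LAYER-H `CellLayerHorizontal` (OPEN, research).**  C2b′ with a NON-flat hot point `y` that is a layer point (`rank Dω(y) ≤ 1`) whose
vorticity derivative kills the horizontal directions (`D_hω(y) = 0`, i.e. `α = 0`: `Dω(y) = β_T T⊗dz`, the reversal surface tangent to `P₀` at `y`, or
`Dω(y) = 0`).  Why it might fail / why open: the most degenerate point type; expected to be isolated on `H` (then a neighbouring point is LAYER-T), but
«isolated» needs a curve-selection argument at a point where the analytic IFT is unavailable; no dynamics used. -/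
def CellLayerHorizontal : Prop :=
    ∀ (C : ℝ) (v : ℝ → EuclideanSpace ℝ (Fin 3) → EuclideanSpace ℝ (Fin 3)) (W : Set (ℝ × EuclideanSpace ℝ (Fin 3))),
      Pinned C v → ThickWindow v W → Peakless v →
      (∀ s < 0, ∀ y, ⟪fderiv ℝ (v s) y (Literature.Analysis.FluidPDE.curl (v s) y), EuclideanSpace.single 2 1⟫_ℝ = 0) →
      IsClosed (hotSet v) → (∀ y ∈ hotSet v, fderiv ℝ (fun x => v (-1) x 2) y = 0) →
      (∀ K O : Set (EuclideanSpace ℝ (Fin 3)), IsCompact K → K.Nonempty → K ⊆ hotSet v → IsOpen O → K ⊆ O →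
        O ∩ hotSet v ⊆ K → False) →
      (∀ y ∈ hotSet v, ∀ r : ℝ, 0 < r →
        ∃ y' : EuclideanSpace ℝ (Fin 3), y' 2 = 0 ∧ dist y' y < r ∧ v (-1) y' 2 ≠ v (-1) 0 2) →
      (∀ y ∈ hotSet v, Literature.Analysis.FluidPDE.curl (v (-1)) y = 0) →
      (∃ y ∈ hotSet v, ¬ HFlat v y ∧ RankLeOne (fderiv ℝ (Literature.Analysis.FluidPDE.curl (v (-1))) y) ∧
        DhZero (fderiv ℝ (Literature.Analysis.FluidPDE.curl (v (-1))) y)) →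
      (∀ y ∈ hotSet v, deriv (fun s => v s y 2) (-1) = v (-1) 0 2 / 2) →
      False

/-- **stub LAYER-H** (OPEN, research). -/
theorem stub_cellLayerHorizontal : CellLayerHorizontal := by
  sorry

/-- **Cell LAYER-T `CellLayerTransverse` (OPEN, research; the GENERIC null ridge).**  C2b′ with a non-flat layer point `y` at which `D_hω(y) ≠ 0`
(`α ≠ 0`: a vortex-reversal layer transverse to the hot plane), TOGETHER WITH the free structure: an analytic regular arc of hot points through `y`
carrying the cover law pointwise (R13 + R12) and the contact-ratio invariant along it (R14: `W(τ)A(0) = W(0)A(τ)`), and the time pin on `H`.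
Why it might fail / why open: kinematic + pins; the layer's viscous dynamics / recurrence along the unbounded arc (R5) is the missing input. -/
def CellLayerTransverse : Prop :=
    ∀ (C : ℝ) (v : ℝ → EuclideanSpace ℝ (Fin 3) → EuclideanSpace ℝ (Fin 3)) (W : Set (ℝ × EuclideanSpace ℝ (Fin 3))),
      Pinned C v → ThickWindow v W → Peakless v →
      (∀ s < 0, ∀ y, ⟪fderiv ℝ (v s) y (Literature.Analysis.FluidPDE.curl (v s) y), EuclideanSpace.single 2 1⟫_ℝ = 0) →
      IsClosed (hotSet v) → (∀ y ∈ hotSet v, fderiv ℝ (fun x => v (-1) x 2) y = 0) →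
      (∀ K O : Set (EuclideanSpace ℝ (Fin 3)), IsCompact K → K.Nonempty → K ⊆ hotSet v → IsOpen O → K ⊆ O →
        O ∩ hotSet v ⊆ K → False) →
      (∀ y ∈ hotSet v, ∀ r : ℝ, 0 < r →
        ∃ y' : EuclideanSpace ℝ (Fin 3), y' 2 = 0 ∧ dist y' y < r ∧ v (-1) y' 2 ≠ v (-1) 0 2) →
      (∀ y ∈ hotSet v, Literature.Analysis.FluidPDE.curl (v (-1)) y = 0) →
      (∃ y ∈ hotSet v, ¬ HFlat v y ∧ RankLeOne (fderiv ℝ (Literature.Analysis.FluidPDE.curl (v (-1))) y) ∧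
        ¬ DhZero (fderiv ℝ (Literature.Analysis.FluidPDE.curl (v (-1))) y) ∧
        ∃ (γ : ℝ → EuclideanSpace ℝ (Fin 3)) (ε : ℝ), γ 0 = y ∧ IsNullArc v γ ε ∧
          ∀ τ ∈ Set.Ioo (-ε) ε, layerW v γ τ * layerA v γ 0 = layerW v γ 0 * layerA v γ τ) →
      (∀ y ∈ hotSet v, deriv (fun s => v s y 2) (-1) = v (-1) 0 2 / 2) →
      False

/-- **stub LAYER-T** (OPEN, research). -/
theorem stub_cellLayerTransverse : CellLayerTransverse := by
  sorry

/-! ## Kernel: C2b′ ⇐ R10 ∧ R12 ∧ R13 ∧ R14 ∧ NULL-FLAT ∧ LAYER-H ∧ LAYER-T (sorry-free; two case splits, no tangent chosen) -/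

/-- **KERNEL `cellC2bRidge_of_null`** — the statement of hot_split's `stub_cellC2bRidge` (v1.6, VERBATIM) from the three null-ridge cells; every structure
stub is consumed (R12 at the split and along the arc, R13 for the arc, R14 for the invariant, R10 for all cells).  Bookkeeping only. -/
theorem cellC2bRidge_of_null (hR10 : HotTimePin) (hR12 : NullCoverLaw) (hR13 : LayerArc) (hR14 : LayerInvariant)
    (hNF : CellNullFlat) (hLH : CellLayerHorizontal) (hLT : CellLayerTransverse) :
    ∀ (C : ℝ) (v : ℝ → EuclideanSpace ℝ (Fin 3) → EuclideanSpace ℝ (Fin 3)) (W : Set (ℝ × EuclideanSpace ℝ (Fin 3))),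
      Pinned C v → ThickWindow v W → Peakless v →
      (∀ s < 0, ∀ y, ⟪fderiv ℝ (v s) y (Literature.Analysis.FluidPDE.curl (v s) y), EuclideanSpace.single 2 1⟫_ℝ = 0) →
      IsClosed (hotSet v) → (∀ y ∈ hotSet v, fderiv ℝ (fun x => v (-1) x 2) y = 0) →
      (∀ K O : Set (EuclideanSpace ℝ (Fin 3)), IsCompact K → K.Nonempty → K ⊆ hotSet v → IsOpen O → K ⊆ O →
        O ∩ hotSet v ⊆ K → False) →
      (∀ y ∈ hotSet v, ∀ r : ℝ, 0 < r →
        ∃ y' : EuclideanSpace ℝ (Fin 3), y' 2 = 0 ∧ dist y' y < r ∧ v (-1) y' 2 ≠ v (-1) 0 2) →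
      (∀ y ∈ hotSet v, Literature.Analysis.FluidPDE.curl (v (-1)) y = 0) →
      False := by
  intro C v W hP hT hK hFL hcl hcrit hR3 hR4 hnull
  have hpin : ∀ y ∈ hotSet v, deriv (fun s => v s y 2) (-1) = v (-1) 0 2 / 2 := hR10 C v hP
  have hcover : ∀ y ∈ hotSet v,
      HFlat v y ∨ RankLeOne (fderiv ℝ (Literature.Analysis.FluidPDE.curl (v (-1))) y) :=
    hR12 C v hP hFL hcl hcrit hR3 hnull
  by_cases hflat : ∀ y ∈ hotSet v, HFlat v y
  · exact hNF C v W hP hT hK hFL hcl hcrit hR3 hR4 hnull hflat hpin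
  · push Not at hflat
    obtain ⟨y, hy, hnf⟩ := hflat
    have hrk : RankLeOne (fderiv ℝ (Literature.Analysis.FluidPDE.curl (v (-1))) y) := (hcover y hy).resolve_left hnf
    by_cases hDh : DhZero (fderiv ℝ (Literature.Analysis.FluidPDE.curl (v (-1))) y)
    · exact hLH C v W hP hT hK hFL hcl hcrit hR3 hR4 hnull ⟨y, hy, hnf, hrk, hDh⟩ hpin
    · obtain ⟨γ, ε, hε, hγ0, harc⟩ := hR13 C v hP hcl hR3 hnull y hy hDh
      have hNA : IsNullArc v γ ε :=
        ⟨hε, fun τ hτ => ⟨(harc τ hτ).1, (harc τ hτ).2.1, (harc τ hτ).2.2, hcover _ (harc τ hτ).1⟩⟩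
      have hinv := hR14 C v hP hFL hcrit hnull γ ε hNA
      exact hLT C v W hP hT hK hFL hcl hcrit hR3 hR4 hnull ⟨y, hy, hnf, hrk, hDh, γ, ε, hγ0, hNA, hinv⟩ hpin

/-- **Residue C2b′ (hot_split `stub_cellC2bRidge`, VERBATIM statement) on this line** ⇐ R10 ∧ R12 ∧ R13 ∧ R14 ∧ NULL-FLAT ∧ LAYER-H ∧ LAYER-T. -/
theorem stub_cellC2bRidge :
    ∀ (C : ℝ) (v : ℝ → EuclideanSpace ℝ (Fin 3) → EuclideanSpace ℝ (Fin 3)) (W : Set (ℝ × EuclideanSpace ℝ (Fin 3))),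
      Pinned C v → ThickWindow v W → Peakless v →
      (∀ s < 0, ∀ y, ⟪fderiv ℝ (v s) y (Literature.Analysis.FluidPDE.curl (v s) y), EuclideanSpace.single 2 1⟫_ℝ = 0) →
      IsClosed (hotSet v) → (∀ y ∈ hotSet v, fderiv ℝ (fun x => v (-1) x 2) y = 0) →
      (∀ K O : Set (EuclideanSpace ℝ (Fin 3)), IsCompact K → K.Nonempty → K ⊆ hotSet v → IsOpen O → K ⊆ O →
        O ∩ hotSet v ⊆ K → False) →
      (∀ y ∈ hotSet v, ∀ r : ℝ, 0 < r →
        ∃ y' : EuclideanSpace ℝ (Fin 3), y' 2 = 0 ∧ dist y' y < r ∧ v (-1) y' 2 ≠ v (-1) 0 2) →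
      (∀ y ∈ hotSet v, Literature.Analysis.FluidPDE.curl (v (-1)) y = 0) →
      False :=
  cellC2bRidge_of_null stub_hotTimePin stub_nullCoverLaw stub_layerArc stub_layerInvariant
    stub_cellNullFlat stub_cellLayerHorizontal stub_cellLayerTransverse

/-! ## The other residue and the shared research stubs (VERBATIM hot_split v1.6) -/

/-- **Residue C2a′ `stub_cellC2aRidge` — THE HOT VORTEX RIDGE ⇒ ∅ (OPEN, research) — VERBATIM hot_split v1.6.**  Not touched by this line (LINE 18
`leaf_uniform` splits it into FLAT LEAF / MORSE LEAF). -/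
theorem stub_cellC2aRidge :
    ∀ (C : ℝ) (v : ℝ → EuclideanSpace ℝ (Fin 3) → EuclideanSpace ℝ (Fin 3)) (W : Set (ℝ × EuclideanSpace ℝ (Fin 3))),
      Pinned C v → ThickWindow v W → Peakless v →
      (∀ s < 0, ∀ y, ⟪fderiv ℝ (v s) y (Literature.Analysis.FluidPDE.curl (v s) y), EuclideanSpace.single 2 1⟫_ℝ = 0) →
      IsClosed (hotSet v) → (∀ y ∈ hotSet v, fderiv ℝ (fun x => v (-1) x 2) y = 0) →
      (∀ K O : Set (EuclideanSpace ℝ (Fin 3)), IsCompact K → K.Nonempty → K ⊆ hotSet v → IsOpen O → K ⊆ O →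
        O ∩ hotSet v ⊆ K → False) →
      (∀ y ∈ hotSet v, ∀ r : ℝ, 0 < r →
        ∃ y' : EuclideanSpace ℝ (Fin 3), y' 2 = 0 ∧ dist y' y < r ∧ v (-1) y' 2 ≠ v (-1) 0 2) →
      (∃ (γ : ℝ → EuclideanSpace ℝ (Fin 3)) (ε : ℝ), 0 < ε ∧ γ 0 ∈ hotSet v ∧
        Literature.Analysis.FluidPDE.curl (v (-1)) (γ 0) ≠ 0 ∧
        ∀ τ ∈ Set.Ioo (-ε) ε, HasDerivAt γ (Literature.Analysis.FluidPDE.curl (v (-1)) (γ τ)) τ ∧ γ τ ∈ hotSet v) →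
      False := by
  sorry

/-- **SHARED STUB S0 ((TH) column) — VERBATIM `stub_localTHEmptyHypNUGRS`** (twist_split = hot_loops v4.3 = loop_island = hot_split). -/
theorem stub_localTHEmptyHypNUGRS :
    ∀ (u : ℝ → EuclideanSpace ℝ (Fin 3) → EuclideanSpace ℝ (Fin 3)) (μ A : ℝ → ℝ → ℝ)
      (U : Set (ℝ × EuclideanSpace ℝ (Fin 3))) (p₀ : ℝ × EuclideanSpace ℝ (Fin 3)),
      IsOpen U → p₀ ∈ U →
      AnalyticOnNhd ℝ (Function.uncurry u) U →
      (∀ p ∈ U, AnalyticAt ℝ (Function.uncurry μ) (p.1, p.2 2)) →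
      (∀ p ∈ U, AnalyticAt ℝ (Function.uncurry A) (p.1, p.2 2)) →
      (∀ p ∈ U, fderiv ℝ (u p.1) p.2 (EuclideanSpace.single 0 1) 1 = fderiv ℝ (u p.1) p.2 (EuclideanSpace.single 1 1) 0) →
      (∀ p ∈ U, fderiv ℝ (u p.1) p.2 (EuclideanSpace.single 0 1) 0 + fderiv ℝ (u p.1) p.2 (EuclideanSpace.single 1 1) 1 +
        fderiv ℝ (u p.1) p.2 (EuclideanSpace.single 2 1) 2 = 0) →
      (∀ p ∈ U, ∀ b : Fin 3, b ≠ 2 →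
        fderiv ℝ (u p.1) p.2 (EuclideanSpace.single 2 1) b =
          μ p.1 (p.2 2) * fderiv ℝ (u p.1) p.2 (EuclideanSpace.single b 1) 2) →
      (∀ p ∈ U,
        (1 - μ p.1 (p.2 2)) *
            (deriv (fun s => u s p.2 2) p.1 + fderiv ℝ (fun y => u p.1 y 2) p.2 (u p.1 p.2)
              - Δ (fun y => u p.1 y 2) p.2) =
          A p.1 (p.2 2) + (deriv (fun s => μ s (p.2 2)) p.1 - deriv (deriv (μ p.1)) (p.2 2)) * u p.1 p.2 2
            + deriv (μ p.1) (p.2 2) / 2 * u p.1 p.2 2 ^ 2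
            - 2 * deriv (μ p.1) (p.2 2) * fderiv ℝ (u p.1) p.2 (EuclideanSpace.single 2 1) 2) →
      fderiv ℝ (fun y => fderiv ℝ (u p₀.1) y (EuclideanSpace.single 2 1) 2) p₀.2 (EuclideanSpace.single 0 1) *
            fderiv ℝ (u p₀.1) p₀.2 (EuclideanSpace.single 1 1) 2 -
          fderiv ℝ (fun y => fderiv ℝ (u p₀.1) y (EuclideanSpace.single 2 1) 2) p₀.2 (EuclideanSpace.single 1 1) *
            fderiv ℝ (u p₀.1) p₀.2 (EuclideanSpace.single 0 1) 2 ≠ 0 →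
      μ p₀.1 (p₀.2 2) ≠ 0 → μ p₀.1 (p₀.2 2) ≠ 1 → deriv (μ p₀.1) (p₀.2 2) ≠ 0 →
      μ p₀.1 (p₀.2 2) < 0 →
      (fderiv ℝ (u p₀.1) p₀.2 (EuclideanSpace.single 0 1) 0 ≠ fderiv ℝ (u p₀.1) p₀.2 (EuclideanSpace.single 1 1) 1 ∨
        fderiv ℝ (u p₀.1) p₀.2 (EuclideanSpace.single 1 1) 0 ≠ 0) →
      u p₀.1 p₀.2 = 0 →
      fderiv ℝ (u p₀.1) p₀.2 (EuclideanSpace.single 0 1) 2 = 0 →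
      fderiv ℝ (u p₀.1) p₀.2 (EuclideanSpace.single 1 1) 2 = 1 → False := by
  sorry

/-- **THE WALL ⟨27893⟩ BY NAME (`stub_wall`)** — item `LoopPeriodRatchet.FrequencyGrowthExponent` (rank 2, OPEN); feeds the landed reduction only. -/
theorem stub_wall : FrequencyGrowthExponent := by
  sorry

/-! ## Kernel: HL3′ ⇐ cells, with A1, C1, C2a ⇐ C2a′, C2b ⇐ C2b′ ALL BY NAME from Theorems (K2-p2 g12/g13 landings) -/

/-- **HL3′ (the statement of `stub_peaklessEmpty`, hot_loops v4.3 / hot_split, VERBATIM) on this line**: hot_split's trichotomy with A1 :=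
`…HotPlaneConst.stub_hotPlaneConst`, C1 := `…ZeroModeNoHotPlane.hotSplit_cellC1`, C2a := `…HotSplitRidgeKernels.cellC2a_of_ridge stub_cellC2aRidge`,
C2b := `…HotSplitRidgeKernels.cellC2b_of_ridge stub_cellC2bRidge`, the frozen law from `…FirstIntegral.stub_firstIntegral`.  Kernel-checked. -/
theorem nullLeaf_peaklessEmpty :
    ∀ (C : ℝ) (v : ℝ → EuclideanSpace ℝ (Fin 3) → EuclideanSpace ℝ (Fin 3)),
      Literature.Analysis.FluidPDE.HasTypeITimeDecay C v →
      ContinuousOn (Function.uncurry v) (Set.Iio (0 : ℝ) ×ˢ Set.univ) →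
      (∀ s t : ℝ, s < t → t < 0 → ∀ x, v t x =
        Literature.Analysis.UnboundedOperators.heatExtension (v s) (t - s) x -
          Literature.Analysis.FluidPDE.oseenDuhamel 1 s v v t x) →
      (∀ t < 0, Literature.Analysis.FluidPDE.VectorCalculus.IsDivFree (v t)) →
      (∀ s < 0, ∀ y, ⟪Literature.Analysis.FluidPDE.curl (v s) y, EuclideanSpace.single 2 1⟫_ℝ = 0) →
      v (-1) 0 2 ≠ 0 → (∀ t < 0, ∀ x, Real.sqrt (-t) * |v t x 2| ≤ |v (-1) 0 2|) →
      (∀ h : EuclideanSpace ℝ (Fin 3), fderiv ℝ (v (-1)) 0 h 2 = 0) →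
      (deriv (fun s => v s 0 2) (-1) = v (-1) 0 2 / 2 ∧ v (-1) 0 2 * (Δ (fun y => v (-1) y 2)) 0 ≤ 0) →
      ∀ W : Set (ℝ × EuclideanSpace ℝ (Fin 3)), IsOpen W → W ⊆ Set.Iio (0 : ℝ) ×ˢ Set.univ →
        (∀ z ∈ W, (Literature.Analysis.FluidPDE.curl (v z.1) z.2 ≠ 0 ∧
            (fderiv ℝ (v z.1) z.2 (EuclideanSpace.single 0 1) 2 ≠ 0 ∨ fderiv ℝ (v z.1) z.2 (EuclideanSpace.single 1 1) 2 ≠ 0) ∧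
            (fderiv ℝ (v z.1) z.2 (EuclideanSpace.single 2 1) 0 ≠ 0 ∨ fderiv ℝ (v z.1) z.2 (EuclideanSpace.single 2 1) 1 ≠ 0)) ∧
          (fderiv ℝ (fun x => fderiv ℝ (v z.1) x (EuclideanSpace.single 2 1) 2) z.2 (EuclideanSpace.single 0 1) *
                fderiv ℝ (v z.1) z.2 (EuclideanSpace.single 1 1) 2 -
              fderiv ℝ (fun x => fderiv ℝ (v z.1) x (EuclideanSpace.single 2 1) 2) z.2 (EuclideanSpace.single 1 1) *
                fderiv ℝ (v z.1) z.2 (EuclideanSpace.single 0 1) 2 ≠ 0)) →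
        (∀ m : ℝ → ℝ → ℝ, ∀ W₁ : Set (ℝ × EuclideanSpace ℝ (Fin 3)), W₁ ⊆ W → IsOpen W₁ → W₁.Nonempty →
            ∃ z ∈ W₁, ∃ b : Fin 3, b ≠ 2 ∧
              fderiv ℝ (v z.1) z.2 (EuclideanSpace.single 2 1) b ≠
                m z.1 (z.2 2) * fderiv ℝ (v z.1) z.2 (EuclideanSpace.single b 1) 2) →
        (∀ r : ℝ, 0 < r → (Metric.ball ((-1 : ℝ), (0 : EuclideanSpace ℝ (Fin 3))) r ∩ W).Nonempty) →
        (∀ (s z₀ σ M : ℝ) (K O : Set (EuclideanSpace ℝ (Fin 3))), s < 0 →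
          ((σ = 1 ∨ σ = -1) ∧ IsCompact K ∧ K.Nonempty ∧ (∀ y ∈ K, y 2 = z₀ ∧ σ * v s y 2 = M) ∧
            IsOpen O ∧ K ⊆ O ∧ (∀ y ∈ O, y 2 = z₀ → σ * v s y 2 ≤ M) ∧
            (∀ y ∈ O, y 2 = z₀ → σ * v s y 2 = M → y ∈ K)) → False) →
        False :=
  -- v1.1 (critic A1): HL3′ ⇐ C2a′ ∧ C2b′ BY NAME through the tree's `…HotSplitCells.peaklessEmpty_of_ridges` (K2-p2 g13, p690711);
  -- `Pinned`/`ThickWindow`/`Peakless`/`hotSet` unfold definitionally to the Theorems file's verbatim binders; C2b′ is the DERIVED `stub_cellC2bRidge`.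
  PoloidalWindowDoorPoloidalWindowRigidityHotSplitCells.peaklessEmpty_of_ridges stub_cellC2aRidge stub_cellC2bRidge

/-! ## Compositions to the crux items BY NAME -/

/-- **The crux `PoloidalWindowRigidity` (K2, stmt-NavierStokesRegularity-19708) BY NAME ⇐ S0 ∧ ⟨27893⟩ ∧ R10 ∧ R12–R14 ∧ NULL-FLAT ∧ LAYER-T ∧ LAYER-H ∧ C2a′**: tree
`…HotLoopsReduction.poloidalWindowRigidity_of_NUGRS_of_growth_of_peakless`.  CONDITIONAL; no summit is proved. -/
theorem PoloidalWindowRigidity_of_nullLeaf :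
    Summit.NavierStokesRegularity.NavierStokesRegularity.Theses.PoloidalWindowDoor.PoloidalWindowRigidity :=
  -- v1.1 (critic A1): `nullLeaf_peaklessEmpty` is HL3′ BY NAME through `…HotSplitCells.peaklessEmpty_of_ridges`; this term is definitionally the tree's
  -- `…HotSplitComposition.poloidalWindowRigidity_of_residues stub_localTHEmptyHypNUGRS stub_wall stub_cellC2aRidge stub_cellC2bRidge` (see the `example`s below).
  PoloidalWindowDoorPoloidalWindowRigidityHotLoopsReduction.poloidalWindowRigidity_of_NUGRS_of_growth_of_peakless
    stub_localTHEmptyHypNUGRS stub_wall nullLeaf_peaklessEmpty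

/-- **The item `LrcModEntire` (stmt-NavierStokesRegularity-20428) BY NAME ⇐ S0 ∧ ⟨27893⟩ ∧ R10 ∧ R12–R14 ∧ NULL-FLAT ∧ LAYER-T ∧ LAYER-H ∧ C2a′.** CONDITIONAL. -/
theorem LrcModEntire_of_nullLeaf :
    Summit.NavierStokesRegularity.NavierStokesRegularity.Theses.PoloidalWindowDoor.LrcModEntire :=
  PoloidalWindowDoorPoloidalWindowRigidityHotLoopsReduction.lrcModEntire_of_NUGRS_of_growth_of_peakless
    stub_localTHEmptyHypNUGRS stub_wall nullLeaf_peaklessEmpty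

/-- v1.1 (critic A1): the same two compositions through the tree's `…HotSplitComposition…_of_residues` BY NAME (S0, wall, C2a′, C2b′ — the residue of
this line being the DERIVED one); `example`s, so the census reads them and the audit counts no duplicate items. -/
example : Summit.NavierStokesRegularity.NavierStokesRegularity.Theses.PoloidalWindowDoor.PoloidalWindowRigidity :=
  PoloidalWindowDoorPoloidalWindowRigidityHotSplitComposition.poloidalWindowRigidity_of_residues
    stub_localTHEmptyHypNUGRS stub_wall stub_cellC2aRidge stub_cellC2bRidge

example : Summit.NavierStokesRegularity.NavierStokesRegularity.Theses.PoloidalWindowDoor.LrcModEntire :=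
  PoloidalWindowDoorPoloidalWindowRigidityHotSplitComposition.lrcModEntire_of_residues
    stub_localTHEmptyHypNUGRS stub_wall stub_cellC2aRidge stub_cellC2bRidge

end Summit.NavierStokesRegularity.NavierStokesRegularity.Cruxes.PoloidalWindowRigidity.NullLeaf
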